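import Literature.Geometry.Lorentzian.TameFamilyOffCompact
import Literature.Geometry.Lorentzian.AFEndBreathingFamily
import Literature.Geometry.Lorentzian.AFEndBreathingData
import Literature.Geometry.Lorentzian.AFEndRestrict
import Literature.Geometry.Lorentzian.TameGenericity
import HarnessLib

/-!
# Breathing a TAME curve member-wise is TAME on the collared end (registered stub
`stub_breatheTame`, line `Sketch` = tame template breathe ∘ trim ∘ kick, crux
`EIHFluxBalance.ModulatedKerrHandoff`, item stmt-FinalStateConjecture-17402)

Let `F : ℝ¹ → InitialDataSet (𝓡 3) X` be TAME on the asymptotically flat end `e`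
(`InitialDataSet.IsTameDataFamily`: jointly smooth, `e` sole, Dafermos–Rodnianski decay with a
continuous mass `M (c)`, `wDist`-continuity at the base parameter), let `B : e.BreathingData z₀ 1`
be breathing data on the unit coordinate ball at `z₀` of `e`'s chart region, `R₁ ≥ ‖z₀‖ + 1`,
`R₁ > e.R`, and `λ : ℝ` any rate. Then the member-wise breathed curve
`c ↦ AFEnd.breatheFamily B (F c) (λ c₀) = (breathe (σ (λ c₀)))^* (F c)` is TAME on the collared
end `e.restrict _` of radius `R₁`:

* jointly smooth — `AFEnd.contMDiff_breatheFamily_family_h/k` with `pr = id`, `τ c = λ c₀`;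
* the collared end is sole — `AFEnd.isSoleEnd_restrict_iff`;
* every member agrees with `F c` on `e.far R₁` (`AFEnd.breatheFamily_eq_of_mem_far`, the moved
  set lies in the coordinate ball `‖x‖ ≤ ‖z₀‖ + 1 ≤ R₁`), hence has the same DR decay with the SAME
  mass `M (c)` (`AFEnd.IsStronglyAsymptoticallyFlatDR.congr_of_eqOn_far`), moved to the collar by
  `AFEnd.isStronglyAsymptoticallyFlatDR_restrict_iff`;
* `wDist → 0` at the base parameter: on the collar, by `AFEnd.wDist_restrict_eq`, the weighted
  distance is a pair of `iSup`s over `R₁ < ‖x‖` of iterated derivatives of differences of the chart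
  components of `e`, which for the breathed members coincide near every such `x` with those of
  `F c`, `F 0` (`AFEnd.hCoeff_eq_of_agree_far` / `kCoeff_eq_of_agree_far`, locality of
  `iteratedFDeriv`); so `wDist (F' c) (F' 0) = wDist (F c) (F 0)` on the collar, which is at most
  `e.wDist (F c) (F 0) → 0` (the `iSup` over the smaller region `R₁ < ‖x‖ ⊆ e.R < ‖x‖`).

Template: `InitialDataSet.isTameDataFamily_restrict_of_agree_off_compact`
(`TameFamilyOffCompact.lean`). Mathlib + the Literature cone only; no definitions, no named facts.
Stub-worker of the line lead prover-line-stmt-FinalStateConjecture-17402-0, 2026-08-17.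
-/

-- the summit-side namespace `Summit.FinalStateConjecture.FinalStateConjecture.…` (summit = problem)
-- repeats a component by design, which the `dupNamespace` linter would flag on every decl.
set_option linter.dupNamespace false

noncomputable section

open scoped Manifold ContDiff Topology ENNReal
open Filter Set Function TopologicalSpace Literature.Geometry.Lorentzian InitialDataSet

namespace Summit.FinalStateConjecture.FinalStateConjecture.Theorems.EIHFluxBalance.TameTemplate

variable {X : Type} [TopologicalSpace X] [ChartedSpace E3 X] [IsManifold (𝓡 3) ∞ X]

/-- Restricting an end does not increase the weighted distance: by `AFEnd.wDist_restrict_eq` the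
distance on `e.restrict _` is the same pair of weighted `iSup`s of the chart components of `e`,
run over the smaller region `R₁ < ‖x‖ ⊆ e.R < ‖x‖`. -/
private theorem wDist_restrict_le_wDist (e : AFEnd X) {R₁ : ℝ} (hR₁ : e.R ≤ R₁)
    (D D' : InitialDataSet (𝓡 3) X) : (e.restrict hR₁).wDist D D' ≤ e.wDist D D' := by
  rw [e.wDist_restrict_eq hR₁ D D']
  unfold AFEnd.wDist
  gcongr with m hm x <;> exact iSup_mono' fun hx ↦ ⟨lt_of_le_of_lt hR₁ hx, le_rfl⟩

/-- Two pairs of data whose sections agree pairwise on the far region `e.far R₁`, `R₁ > e.R`, have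
the same weighted distance on the collared end `e.restrict _` of radius `R₁`: the `iSup`s of
`AFEnd.wDist_restrict_eq` run over `R₁ < ‖x‖`, where the differences of the chart components of
`e` (`AFEnd.hCoeff_eq_of_agree_far` / `kCoeff_eq_of_agree_far`, `max R₁ e.R = R₁`) agree on the
open neighbourhood `{R₁ < ‖y‖}` of `x`, so their `iteratedFDeriv`s at `x` agree
(`Filter.EventuallyEq.iteratedFDeriv`). -/
private theorem wDist_restrict_congr_of_agree_far (e : AFEnd X) {R₁ : ℝ} (hR₁ : e.R < R₁)
    {D₁ D₁' D₂ D₂' : InitialDataSet (𝓡 3) X}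
    (h₁ : ∀ q ∈ e.far R₁, D₁.h.inner q = D₂.h.inner q ∧ D₁.k q = D₂.k q)
    (h₁' : ∀ q ∈ e.far R₁, D₁'.h.inner q = D₂'.h.inner q ∧ D₁'.k q = D₂'.k q) :
    (e.restrict hR₁.le).wDist D₁ D₁' = (e.restrict hR₁.le).wDist D₂ D₂' := by
  have hmax : max R₁ e.R = R₁ := max_eq_left hR₁.le
  have hh : ∀ y : E3, R₁ < ‖y‖ → e.hCoeff D₁ y = e.hCoeff D₂ y :=
    fun y hy ↦ e.hCoeff_eq_of_agree_far (fun q hq ↦ (h₁ q hq).1) (by rwa [hmax])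
  have hh' : ∀ y : E3, R₁ < ‖y‖ → e.hCoeff D₁' y = e.hCoeff D₂' y :=
    fun y hy ↦ e.hCoeff_eq_of_agree_far (fun q hq ↦ (h₁' q hq).1) (by rwa [hmax])
  have hk : ∀ y : E3, R₁ < ‖y‖ → e.kCoeff D₁ y = e.kCoeff D₂ y :=
    fun y hy ↦ e.kCoeff_eq_of_agree_far (fun q hq ↦ (h₁ q hq).2) (by rwa [hmax])
  have hk' : ∀ y : E3, R₁ < ‖y‖ → e.kCoeff D₁' y = e.kCoeff D₂' y :=
    fun y hy ↦ e.kCoeff_eq_of_agree_far (fun q hq ↦ (h₁' q hq).2) (by rwa [hmax])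
  rw [e.wDist_restrict_eq hR₁.le, e.wDist_restrict_eq hR₁.le]
  have hopen : IsOpen {y : E3 | R₁ < ‖y‖} := isOpen_lt continuous_const continuous_norm
  congr 1
  · refine iSup_congr fun m ↦ iSup_congr fun _ ↦ iSup_congr fun x ↦ iSup_congr fun hx ↦ ?_
    have hev : (fun y ↦ e.hCoeff D₁ y - e.hCoeff D₁' y) =ᶠ[𝓝 x]
        fun y ↦ e.hCoeff D₂ y - e.hCoeff D₂' y := by
      filter_upwards [hopen.mem_nhds (show R₁ < ‖x‖ from hx)] with y hy
      rw [hh y hy, hh' y hy]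
    rw [(hev.iteratedFDeriv ℝ m).eq_of_nhds]
  · refine iSup_congr fun m ↦ iSup_congr fun _ ↦ iSup_congr fun x ↦ iSup_congr fun hx ↦ ?_
    have hev : (fun y ↦ e.kCoeff D₁ y - e.kCoeff D₁' y) =ᶠ[𝓝 x]
        fun y ↦ e.kCoeff D₂ y - e.kCoeff D₂' y := by
      filter_upwards [hopen.mem_nhds (show R₁ < ‖x‖ from hx)] with y hy
      rw [hk y hy, hk' y hy]
    rw [(hev.iteratedFDeriv ℝ m).eq_of_nhds]

/-- **Breathing a TAME curve member-wise is TAME on the collared end** (registered stub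
`stub_breatheTame` of the line `Sketch` of the crux `EIHFluxBalance.ModulatedKerrHandoff`). Let `F`
be tame on the end `e`, `B` breathing data on the unit coordinate ball at `z₀` of `e`'s chart
region, `R₁ ≥ ‖z₀‖ + 1`, `R₁ > e.R`, and `λ : ℝ` any rate. Then
`c ↦ (breathe (σ (λ c₀)))^* (F c)` is tame on `e.restrict R₁`: jointly smooth
(`AFEnd.contMDiff_breatheFamily_family_h/k` with `pr = id`, `τ c = λ c₀`); the collared end is sole
(`AFEnd.isSoleEnd_restrict_iff`); every member agrees with `F c` on `e.far R₁`
(`AFEnd.breatheFamily_eq_of_mem_far`), hence has the same DR decay and mass `M (c)` there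
(`AFEnd.IsStronglyAsymptoticallyFlatDR.congr_of_eqOn_far`,
`AFEnd.isStronglyAsymptoticallyFlatDR_restrict_iff`); and its `wDist` to the base member on the
collared end — read through `e`'s chart beyond `R₁` (`AFEnd.wDist_restrict_eq`,
`AFEnd.hCoeff_eq_of_agree_far` / `kCoeff_eq_of_agree_far`) — equals that of `F c` to `F 0`, at most
`e.wDist (F c) (F 0) → 0` (squeeze against the constant `0`). -/
theorem stub_breatheTame :
    ∀ (X : Type) [TopologicalSpace X] [ChartedSpace E3 X] [IsManifold (𝓡 3) ((⊤ : ℕ∞) : WithTop ℕ∞) X] [T2Space X] [SecondCountableTopology X] [ConnectedSpace X],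
      ∀ (e : AFEnd X) (z₀ : E3) (B : e.BreathingData z₀ 1) (R₁ : ℝ) (hzR : ‖z₀‖ + 1 ≤ R₁)
        (hR : e.R < R₁) (lam : ℝ) (F : EuclideanSpace ℝ (Fin 1) → InitialDataSet (𝓡 3) X),
        IsTameDataFamily e 1 F →
          IsTameDataFamily (e.restrict hR.le) 1
            (fun c ↦ AFEnd.breatheFamily B (F c) (lam * c 0)) := by
  intro X _ _ _ _ _ _ e z₀ B R₁ hzR hR lam F hF
  obtain ⟨hsm, hsole, ⟨M, hMc, hM⟩, hlim⟩ := hF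
  -- the rate map `c ↦ λ c₀` is smooth
  have hτ : ContDiff ℝ ∞ (fun c : EuclideanSpace ℝ (Fin 1) ↦ lam * c 0) :=
    contDiff_const.mul
      (contDiff_piLp_apply (𝕜 := ℝ) (n := ∞) (p := 2) (E := fun _ : Fin 1 => ℝ) (i := 0))
  -- every breathed member agrees with the corresponding member of `F` on `e.far R₁`
  have hagree : ∀ (c : EuclideanSpace ℝ (Fin 1)) (t : ℝ), ∀ q ∈ e.far R₁,
      (AFEnd.breatheFamily B (F c) t).h.inner q = (F c).h.inner q ∧
        (AFEnd.breatheFamily B (F c) t).k q = (F c).k q :=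
    fun c t q hq ↦ AFEnd.breatheFamily_eq_of_mem_far B (F c) t hzR hq
  refine ⟨⟨?_, ?_⟩, (e.isSoleEnd_restrict_iff hR.le).2 hsole, ⟨M, hMc, fun c ↦ ?_⟩, ?_⟩
  · -- joint smoothness of the metrics
    exact AFEnd.contMDiff_breatheFamily_family_h B (pr := fun c : EuclideanSpace ℝ (Fin 1) ↦ c)
      (τ := fun c : EuclideanSpace ℝ (Fin 1) ↦ lam * c 0) contDiff_id hτ hsm.1
  · -- joint smoothness of the second fundamental forms
    exact AFEnd.contMDiff_breatheFamily_family_k B (pr := fun c : EuclideanSpace ℝ (Fin 1) ↦ c)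
      (τ := fun c : EuclideanSpace ℝ (Fin 1) ↦ lam * c 0) contDiff_id hτ hsm.2
  · -- decay of each member on the collared end, with the mass of the corresponding member of `F`
    rw [e.isStronglyAsymptoticallyFlatDR_restrict_iff hR.le]
    exact (hM c).congr_of_eqOn_far (R₀ := R₁) (fun q hq ↦ (hagree c _ q hq).1)
      (fun q hq ↦ (hagree c _ q hq).2)
  · -- `wDist`-continuity at the base parameter, squeezed between `0` and `e.wDist (F c) (F 0)`
    refine tendsto_of_tendsto_of_tendsto_of_le_of_le tendsto_const_nhds hlim
      (fun _ ↦ zero_le) fun c ↦ ?_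
    change (e.restrict hR.le).wDist (AFEnd.breatheFamily B (F c) (lam * c 0))
        (AFEnd.breatheFamily B (F 0) (lam * (0 : EuclideanSpace ℝ (Fin 1)) 0)) ≤
      e.wDist (F c) (F 0)
    rw [wDist_restrict_congr_of_agree_far e hR (hagree c (lam * c 0))
      (hagree 0 (lam * (0 : EuclideanSpace ℝ (Fin 1)) 0))]
    exact wDist_restrict_le_wDist e hR.le _ _

end Summit.FinalStateConjecture.FinalStateConjecture.Theorems.EIHFluxBalance.TameTemplate

end
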